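import Literature.MathematicalPhysics.QuantumFieldTheory.Balaban1983to89.B1Eq324BenfattoKernelSect5TupleClustersAnchored
import Literature.MathematicalPhysics.QuantumFieldTheory.Balaban1983to89.B1Eq324BenfattoKernelSect5FreeStep
import Literature.MathematicalPhysics.QuantumFieldTheory.Balaban1983to89.B1Eq324BenfattoSect5HlCumulants
import HarnessLib

/-!
# `Balaban1983to89.B1Eq324BenfattoKernelSect5HlCumulants` — [BenfattoEtAl1978] (5.11) p. 155 INSIDE THE FREE CUMULANTS UNDER THE CENTRED GAUSSIAN FIELD
# `𝒩(0,K)` OF A GENERAL KERNEL: dropping the far-reaching part `H^{(l)}` of `H_J = Ĥ_J + H^{(l)}` changes every truncated expectation by an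
# EXTENSIVE, EXPONENTIALLY SMALL amount — `|𝓔^T_{𝒩(0,K)}(H_J; k) − 𝓔^T_{𝒩(0,K)}(Ĥ_J; k)| ≤ 2^k·C_k·(|J|·A·e^{−(c/2)w}·S₁)·(A·S₂)^{k−1}` — with the
# covariance decay and the diagonal DISPLAYED AS ROWS, PROVED (free side of the class road, `K_ref = K_Λ`; reads row 5 `…KernelSect5TupleClustersAnchored`)

statement-level skeleton of published theorems with citation tags; proofs where landed; nothing here is a claim about the
Yang–Mills mass gap

WHY THIS MODULE (cell `pub-ymgap`, seat `dag-n08-b` gen 12; node N08 [Balaban1985UV3]; the [BenfattoEtAl1978] source chain behind the (α)-row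
`h324c`; FREE SIDE of the class port, `N08-PORT-MAP-CLUSTER-SIDE.md` §3 lists `…HlCumulants` among the free-side stems).  `…Sect5HlCumulants` (seat n08-c,
gen 19) proves (5.11) inside the free cumulants under PRINT'S reference field `P̂₀ = P0 d α β` (= `condField d α β ∅ 0`), reading it through exactly
two facts: the moment row of the slots (`…Sect5SlotMoments.tupleSum_condField_moments` at `Γ = ∅`) and Appendix D anchored at the remainder slot
(`…TupleClustersAnchored.abs_ursellOf_tupleSums_condField_le_anchored_of_uniform` at `Γ = ∅`).  On the class road the free-side identification runs
under the CENTRED Gaussian field `gaussianFieldOfKernel K` of the class covariance `K = K_Λ` (design note «K_REF OF RECORD», n08-b g11), so the two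
statements are needed with `P̂₀ ↦ gaussianFieldOfKernel K` and the free field's inputs displayed as ROWS: R0 `hK : IsPosSemidefKernel K`, R1
`hdiag : ∀ y, K y y ≤ c₀`, R2 `hdec : ∀ x y, |K x y| ≤ K₀·exp(−(δ₀·ℓ¹(x,y)))` read at `0 < δ ≤ δ₀` (`K₀ ≥ 1`).  This file is that edition: the SAME
proof with the two suppliers replaced by `…KernelSect5FreeStep.tupleSum_gaussianFieldOfKernel_moments` (p610935) and row 5 §3
`…KernelSect5TupleClustersAnchored.abs_ursellOf_tupleSums_kernel_le_anchored_of_uniform`, and `max(1, C₀₀) ↦ K₀`; `hatH_eq_tupleSum`,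
`…Sect5Eq511` (`hamiltonian_eq_hatH_add_Hl`, `Hl_eq_sum_remainder`, `le_connLength_of_mem_remainder`), `…SlotMasses.classSum_le_card_mul`,
`…RegionCount.decayWeighted_classSum_le_card_mul` and `…FreeCumulants.cumulantOf_add_sub_eq_of_moments` are measure-free and consumed BY NAME.

DICTIONARY.  `𝓔^T(X;k)` ↦ `truncatedExp (gaussianFieldOfKernel K) X k`; `Σ_{k≤t}…/k!` ↦ `cumulantSum (gaussianFieldOfKernel K) X t`; `H_J`, `Ĥ_J`,
`H^{(l)}`, `M_l`, `M̂`, `c = ϰ/2 − (δ/2)D²√d` exactly as in the concrete module; `K₀` (row R2) in place of `max(1, C₀₀)`.  The concrete module is the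
instance `K := freeCov d α β` (R2 from `…AppendixC2.freeCov_le_self_mul_pow_l1` at `δ₀ = log((2d+α²)/2d)`).

WHAT IS PROVED (theorems only; no definition, no named fact, no `sorry`; axioms standard).
* ★★ **`abs_truncatedExp_kernel_hamiltonian_sub_hatH_le`** — `|𝓔^T_{𝒩(0,K)}(H_J; k+1) − 𝓔^T_{𝒩(0,K)}(Ĥ_J; k+1)| ≤ 2^{k+1}·2^{(k+1)D}2^{2^{(k+1)D}}K₀^{(k+1)D}·M_l·M̂^k`.
* ★ `abs_cumulantSum_kernel_hamiltonian_sub_hatH_le` — the same summed over `1 ≤ k ≤ t` with `1/k!`.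

HONEST SCOPE / NOT HERE.  (i) Rows DISPLAYED, not discharged (at `K = K_Λ`: J1 `…KernelOfPrecision.kernel_self_le` / `abs_kernel_le_exp`, or
`…ClassAppendixC.inv_apply_self_pos_le` / `abs_inv_apply_le_exp`, with the class distance compared to `ℓ¹` — the instantiation row's business); (ii)
the choice of `δ`, `w ≍ M·b^{3/2}` and the insertion into `errTerm` are the assembly's; (iii) free side of an UNCOMMISSIONED port (plan g81 (II), START-LIST
v11 §n08): nothing is chained to it here; no generalised Basic Lemma is stated; nothing of [Balaban1985UV3] (41)/(47)/(5) is asserted; count-neutral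
for N08; nothing about d = 4, the continuum, OS axioms, a mass gap or the Clay problem.
-/

noncomputable section

open Finset MeasureTheory
open scoped BigOperators NNReal

namespace Literature.MathematicalPhysics.QuantumFieldTheory.Balaban1983to89.B1Eq324BenfattoKernelSect5HlCumulants

open _root_.MeasureTheory _root_.ProbabilityTheory
open Literature.Probability.LatticeModels (ursellOf cumulantOf)
open Literature.MathematicalPhysics.QuantumFieldTheory
open Literature.MathematicalPhysics.QuantumFieldTheory.Balaban1983to89.B1Eq324BenfattoLemma
open Literature.MathematicalPhysics.QuantumFieldTheory.Balaban1983to89.B1Eq324BenfattoConnLength (connLength_nonneg)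
open Literature.MathematicalPhysics.QuantumFieldTheory.Balaban1983to89.B1Eq324BenfattoSect5Boxes
open Literature.MathematicalPhysics.QuantumFieldTheory.Balaban1983to89.B1Eq324BenfattoSect5Eq511
open Literature.MathematicalPhysics.QuantumFieldTheory.Balaban1983to89.B1Eq324BenfattoSect5SlotMasses (classSum_le_card_mul)
open Literature.MathematicalPhysics.QuantumFieldTheory.Balaban1983to89.B1Eq324BenfattoSect5RegionCount (decayWeighted_classSum_le_card_mul)
open Literature.MathematicalPhysics.QuantumFieldTheory.Balaban1983to89.B1Eq324BenfattoKernelSect5TupleClustersAnchored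
  (abs_ursellOf_tupleSums_kernel_le_anchored_of_uniform)
open Literature.MathematicalPhysics.QuantumFieldTheory.Balaban1983to89.B1Eq324BenfattoKernelSect5FreeStep (tupleSum_gaussianFieldOfKernel_moments)
open Literature.MathematicalPhysics.QuantumFieldTheory.Balaban1983to89.B1Eq324BenfattoSect5FreeCumulants (cumulantOf_add_sub_eq_of_moments)
open Literature.MathematicalPhysics.QuantumFieldTheory.Balaban1983to89.B1Eq324BenfattoSect5HlCumulants (hatH_eq_tupleSum)

variable {d : ℕ} {K : B1Eq324BenfattoLemma.Site d → B1Eq324BenfattoLemma.Site d → ℝ}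
variable {s D : ℕ} {ϰ : ℝ} {a : Coef d} {J : Finset (B1Eq324BenfattoLemma.Site d)} {L : ℕ}
variable {B : Finset (B1Eq324BenfattoLemma.Site d)}

/-- **(5.11) INSIDE THE FREE CUMULANTS, CENTRED KERNEL FIELD**: for coefficients supported in `J` with `|A| ≤ A`, `L ≥ 1`, `B ⊇` the tesserae
meeting `J`, rows R0 `hK`, R1 `hdiag`, R2 `hdec` (`K₀ ≥ 1`), a rate `0 < δ ≤ δ₀` with `δD²√d < ϰ`, every corridor width `w` and every order:
`|𝓔^T_{𝒩(0,K)}(H_J; k+1) − 𝓔^T_{𝒩(0,K)}(Ĥ_J; k+1)| ≤ 2^{k+1}·2^{(k+1)D}2^{2^{(k+1)D}}K₀^{(k+1)D}·M_l·M̂^k` with `M_l`, `M̂` as in the concrete module —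
the colourings of `{Ĥ_J, H^{(l)}}` using `H^{(l)}` (`…FreeCumulants.cumulantOf_add_sub_eq_of_moments`, moments by
`…KernelSect5FreeStep.tupleSum_gaussianFieldOfKernel_moments`), each bounded by row 5 §3
`…KernelSect5TupleClustersAnchored.abs_ursellOf_tupleSums_kernel_le_anchored_of_uniform`; masses by `…SlotMasses.classSum_le_card_mul` /
`…RegionCount.decayWeighted_classSum_le_card_mul` (measure-free).  The concrete `…HlCumulants.abs_truncatedExp_hamiltonian_sub_hatH_le` is the
instance `K := freeCov d α β`. [cite: BenfattoEtAl1978, (5.11) p.155, (2.7) p.147, Appendix D p.166] -/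
theorem abs_truncatedExp_kernel_hamiltonian_sub_hatH_le (hK : IsPosSemidefKernel K) {c₀ : ℝ≥0} (hdiag : ∀ y, K y y ≤ c₀)
    {K₀ δ₀ : ℝ} (hK₀ : 1 ≤ K₀)
    (hdec : ∀ x y : B1Eq324BenfattoLemma.Site d, |K x y| ≤ K₀ * Real.exp (-(δ₀ * ∑ jj, |((x jj : ℝ) - (y jj : ℝ))|)))
    (hJ : CoefSupportedIn a J) {A : ℝ}
    (hA0 : 0 ≤ A) (hA : ∀ (p : ℕ) (Δ : Fin p → B1Eq324BenfattoLemma.Site d) (n : Fin p → ℕ), |a p Δ n| ≤ A)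
    (hL : 0 < L) (hB : J.image (boxIndex L) ⊆ B) {δ : ℝ} (hδ : 0 < δ) (hδle : δ ≤ δ₀)
    (hδϰ : δ * ((D : ℝ) ^ 2 * Real.sqrt d) < ϰ) (w k : ℕ) :
    |truncatedExp (gaussianFieldOfKernel K) (hamiltonian s D ϰ a J) (k + 1) - truncatedExp (gaussianFieldOfKernel K) (hatH s D ϰ a L w B) (k + 1)| ≤
      2 ^ (k + 1) * (2 ^ ((k + 1) * D) * 2 ^ 2 ^ ((k + 1) * D) * K₀ ^ ((k + 1) * D)) *
        ((A * Real.exp (δ / 2 * ((D : ℝ) ^ 2 * d)) *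
            Real.exp (-((ϰ / 2 - δ / 2 * ((D : ℝ) ^ 2 * Real.sqrt d)) / 2 * w))) * J.card *
          ∑ p ∈ Finset.Icc 1 s, ((admissible p D).card : ℝ) *
            ((2 / (1 - Real.exp (-((ϰ / 2 - δ / 2 * ((D : ℝ) ^ 2 * Real.sqrt d)) / 2 / (p : ℕ) / Real.sqrt d))) *
              Real.exp ((ϰ / 2 - δ / 2 * ((D : ℝ) ^ 2 * Real.sqrt d)) / 2 / (p : ℕ) / Real.sqrt d)) ^ d) ^ (p - 1)) *
        (A * Real.exp (δ / 2 * ((D : ℝ) ^ 2 * d)) *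
          ((1 : ℝ) * (2 / (1 - Real.exp (-(δ / (2 * ((k + 1 : ℕ) : ℝ)) / Real.sqrt d))) *
            Real.exp (δ / (2 * ((k + 1 : ℕ) : ℝ)) / Real.sqrt d)) ^ d) *
          ∑ p ∈ Finset.Icc 1 s, ((admissible p D).card : ℝ) *
            ((2 / (1 - Real.exp (-((ϰ / 2 - δ / 2 * ((D : ℝ) ^ 2 * Real.sqrt d)) / (p : ℕ) / Real.sqrt d))) *
              Real.exp ((ϰ / 2 - δ / 2 * ((D : ℝ) ^ 2 * Real.sqrt d)) / (p : ℕ) / Real.sqrt d)) ^ d) ^ (p - 1)) ^ k := by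
  classical
  -- constants
  set c : ℝ := ϰ / 2 - δ / 2 * ((D : ℝ) ^ 2 * Real.sqrt d) with hc
  have hc0 : 0 < c := by rw [hc]; linarith
  have hK₀0 : 0 ≤ K₀ := zero_le_one.trans hK₀
  set C : ℝ := 2 ^ ((k + 1) * D) * 2 ^ 2 ^ ((k + 1) * D) * K₀ ^ ((k + 1) * D) with hC
  have hC0 : 0 ≤ C := by positivity
  set S₁ : ℝ := ∑ p ∈ Finset.Icc 1 s, ((admissible p D).card : ℝ) *
    ((2 / (1 - Real.exp (-(c / 2 / (p : ℕ) / Real.sqrt d))) * Real.exp (c / 2 / (p : ℕ) / Real.sqrt d)) ^ d) ^ (p - 1) with hS₁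
  set S₂ : ℝ := ∑ p ∈ Finset.Icc 1 s, ((admissible p D).card : ℝ) *
    ((2 / (1 - Real.exp (-(c / (p : ℕ) / Real.sqrt d))) * Real.exp (c / (p : ℕ) / Real.sqrt d)) ^ d) ^ (p - 1) with hS₂
  set Ml : ℝ := (A * Real.exp (δ / 2 * ((D : ℝ) ^ 2 * d)) * Real.exp (-(c / 2 * w))) * J.card * S₁ with hMl_def
  set Mh : ℝ := A * Real.exp (δ / 2 * ((D : ℝ) ^ 2 * d)) *
    ((1 : ℝ) * (2 / (1 - Real.exp (-(δ / (2 * ((k + 1 : ℕ) : ℝ)) / Real.sqrt d))) *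
      Real.exp (δ / (2 * ((k + 1 : ℕ) : ℝ)) / Real.sqrt d)) ^ d) * S₂ with hMh_def
  show _ ≤ 2 ^ (k + 1) * C * Ml * Mh ^ k
  -- the reference field
  set μ := gaussianFieldOfKernel K with hμ
  haveI : IsProbabilityMeasure μ := isProbabilityMeasure_gaussianFieldOfKernel hK
  -- the two tuple classes: `Ĥ_J` (colour 0) and `H^{(l)}` (colour 1)
  set cls : Fin 2 → (p : ℕ) → Finset (Fin p → J) :=
    fun cc p => if cc = 0 then hatTuples J p L w B else Finset.univ \ hatTuples J p L w B with hcls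
  set Y : Fin 2 → (B1Eq324BenfattoLemma.Site d → ℝ) → ℝ :=
    fun cc z => ∑ p ∈ Finset.Icc 1 s, ∑ Δ ∈ cls cc p, ∑ n ∈ admissible p D, term ϰ a z p Δ n with hY
  have hY0 : ∀ z, hatH s D ϰ a L w B z = Y 0 z := fun z => by
    rw [hY, hatH_eq_tupleSum hJ hL w z]
    simp only [hcls, if_true]
  have hY1 : ∀ z, Hl s D ϰ a J L w B z = Y 1 z := fun z => by
    rw [hY, Hl_eq_sum_remainder hJ hL]
    simp only [hcls, one_ne_zero, if_false]
  have hH : ∀ z, hamiltonian s D ϰ a J z = Y 0 z + Y 1 z := fun z => by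
    rw [hamiltonian_eq_hatH_add_Hl s D ϰ a J L w B z, hY0, hY1]
  -- moments under the free field
  have hmom : ∀ cc, AEStronglyMeasurable (Y cc) μ ∧ ∀ q : ℕ, Integrable (fun z => |Y cc z| ^ q) μ := by
    intro cc
    exact tupleSum_gaussianFieldOfKernel_moments (s := s) (D := D) (κ := ϰ) (a := a) hK (fun y _ => hdiag y) (cls cc)
  -- the colouring expansion of the difference
  have hexp := cumulantOf_add_sub_eq_of_moments (μ := μ) (Y := fun cc z => Y cc z) (fun cc => (hmom cc).1) k
    (fun cc p _ => (hmom cc).2 p)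
  have hlhs : truncatedExp (gaussianFieldOfKernel K) (hamiltonian s D ϰ a J) (k + 1) -
        truncatedExp (gaussianFieldOfKernel K) (hatH s D ϰ a L w B) (k + 1) =
      cumulantOf (fun r => ∫ z, (Y 0 z + Y 1 z) ^ r ∂μ) (k + 1) - cumulantOf (fun r => ∫ z, (Y 0 z) ^ r ∂μ) (k + 1) := by
    simp only [truncatedExp, hμ]
    congr 2
    · funext r; exact integral_congr_ae (ae_of_all _ fun z => by beta_reduce; rw [hH z])
    · funext r; exact integral_congr_ae (ae_of_all _ fun z => by beta_reduce; rw [hY0 z])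
  rw [hlhs, hexp]
  -- per colouring using colour 1: the anchored cluster bound
  have hexpθ : ∀ {p : ℕ} (Δ : Fin p → J),
      Real.exp (-(ϰ / 2) * connLength fun i => (Δ i : B1Eq324BenfattoLemma.Site d)) *
        Real.exp (δ / 2 * ((D : ℝ) ^ 2 * (Real.sqrt d * connLength (fun i => (Δ i : B1Eq324BenfattoLemma.Site d)) + d))) =
        Real.exp (δ / 2 * ((D : ℝ) ^ 2 * d)) * Real.exp (-(c * connLength fun i => (Δ i : B1Eq324BenfattoLemma.Site d))) := by
    intro p Δ
    rw [← Real.exp_add, ← Real.exp_add]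
    congr 1
    rw [hc]; ring
  -- the uniform decay-weighted mass of any class, anchored at one tessera
  have hMh : ∀ (cc : Fin 2) (y : B1Eq324BenfattoLemma.Site d),
      ∑ p ∈ Finset.Icc 1 s, ∑ Δ ∈ cls cc p, ∑ n ∈ admissible p D,
        |a p (fun i => (Δ i : B1Eq324BenfattoLemma.Site d)) n| *
          Real.exp (-(ϰ / 2) * connLength fun i => (Δ i : B1Eq324BenfattoLemma.Site d)) *
          (Real.exp (δ / 2 * ((D : ℝ) ^ 2 * (Real.sqrt d * connLength (fun i => (Δ i : B1Eq324BenfattoLemma.Site d)) + d))) *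
            Real.exp (-(δ / (2 * Fintype.card (Fin (k + 1))) * ∑ jj, |((y jj : ℝ) -
              ((if h : 0 < p then (Δ ⟨0, h⟩ : B1Eq324BenfattoLemma.Site d) else (0 : B1Eq324BenfattoLemma.Site d)) jj : ℝ))|))) ≤ Mh := by
    intro cc y
    rw [Fintype.card_fin]
    have hc₂ : 0 < δ / (2 * ((k + 1 : ℕ) : ℝ)) := by positivity
    have hw : ∀ (p : ℕ) (hp : p ∈ Finset.Icc 1 s), ∀ Δ ∈ cls cc p, ∀ n ∈ admissible p D,
        |a p (fun i => (Δ i : B1Eq324BenfattoLemma.Site d)) n| *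
          Real.exp (-(ϰ / 2) * connLength fun i => (Δ i : B1Eq324BenfattoLemma.Site d)) *
          (Real.exp (δ / 2 * ((D : ℝ) ^ 2 * (Real.sqrt d * connLength (fun i => (Δ i : B1Eq324BenfattoLemma.Site d)) + d))) *
            Real.exp (-(δ / (2 * ((k + 1 : ℕ) : ℝ)) * ∑ jj, |((y jj : ℝ) -
              ((if h : 0 < p then (Δ ⟨0, h⟩ : B1Eq324BenfattoLemma.Site d) else (0 : B1Eq324BenfattoLemma.Site d)) jj : ℝ))|))) ≤
          A * Real.exp (δ / 2 * ((D : ℝ) ^ 2 * d)) * Real.exp (-(c * connLength fun i => (Δ i : B1Eq324BenfattoLemma.Site d))) *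
            Real.exp (-(δ / (2 * ((k + 1 : ℕ) : ℝ)) * ∑ jj, |((y jj : ℝ) -
              ((Δ ⟨0, (Finset.mem_Icc.1 hp).1⟩ : B1Eq324BenfattoLemma.Site d) jj : ℝ))|)) := by
      intro p hp Δ _ n _
      rw [dif_pos (show 0 < p from (Finset.mem_Icc.1 hp).1)]
      have hre : |a p (fun i => (Δ i : B1Eq324BenfattoLemma.Site d)) n| *
          Real.exp (-(ϰ / 2) * connLength fun i => (Δ i : B1Eq324BenfattoLemma.Site d)) *
          (Real.exp (δ / 2 * ((D : ℝ) ^ 2 * (Real.sqrt d * connLength (fun i => (Δ i : B1Eq324BenfattoLemma.Site d)) + d))) *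
            Real.exp (-(δ / (2 * ((k + 1 : ℕ) : ℝ)) * ∑ jj, |((y jj : ℝ) -
              ((Δ ⟨0, (Finset.mem_Icc.1 hp).1⟩ : B1Eq324BenfattoLemma.Site d) jj : ℝ))|))) =
          |a p (fun i => (Δ i : B1Eq324BenfattoLemma.Site d)) n| *
            ((Real.exp (-(ϰ / 2) * connLength fun i => (Δ i : B1Eq324BenfattoLemma.Site d)) *
              Real.exp (δ / 2 * ((D : ℝ) ^ 2 * (Real.sqrt d * connLength (fun i => (Δ i : B1Eq324BenfattoLemma.Site d)) + d)))) *
            Real.exp (-(δ / (2 * ((k + 1 : ℕ) : ℝ)) * ∑ jj, |((y jj : ℝ) -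
              ((Δ ⟨0, (Finset.mem_Icc.1 hp).1⟩ : B1Eq324BenfattoLemma.Site d) jj : ℝ))|))) := by ring
      rw [hre, hexpθ Δ]
      have hpos : 0 ≤ Real.exp (δ / 2 * ((D : ℝ) ^ 2 * d)) * Real.exp (-(c * connLength fun i => (Δ i : B1Eq324BenfattoLemma.Site d))) *
          Real.exp (-(δ / (2 * ((k + 1 : ℕ) : ℝ)) * ∑ jj, |((y jj : ℝ) -
            ((Δ ⟨0, (Finset.mem_Icc.1 hp).1⟩ : B1Eq324BenfattoLemma.Site d) jj : ℝ))|)) := by positivity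
      calc |a p (fun i => (Δ i : B1Eq324BenfattoLemma.Site d)) n| *
            (Real.exp (δ / 2 * ((D : ℝ) ^ 2 * d)) * Real.exp (-(c * connLength fun i => (Δ i : B1Eq324BenfattoLemma.Site d))) *
              Real.exp (-(δ / (2 * ((k + 1 : ℕ) : ℝ)) * ∑ jj, |((y jj : ℝ) -
                ((Δ ⟨0, (Finset.mem_Icc.1 hp).1⟩ : B1Eq324BenfattoLemma.Site d) jj : ℝ))|)))
          ≤ A * (Real.exp (δ / 2 * ((D : ℝ) ^ 2 * d)) * Real.exp (-(c * connLength fun i => (Δ i : B1Eq324BenfattoLemma.Site d))) *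
              Real.exp (-(δ / (2 * ((k + 1 : ℕ) : ℝ)) * ∑ jj, |((y jj : ℝ) -
                ((Δ ⟨0, (Finset.mem_Icc.1 hp).1⟩ : B1Eq324BenfattoLemma.Site d) jj : ℝ))|))) :=
            mul_le_mul_of_nonneg_right (hA p _ n) hpos
        _ = _ := by ring
    have h := decayWeighted_classSum_le_card_mul (s := s) (D := D) (Jr := J) hc0 hc₂ (mul_nonneg hA0 (Real.exp_pos _).le)
      (cls cc) ({y} : Finset (B1Eq324BenfattoLemma.Site d)) (fun z => ∑ jj, |((y jj : ℝ) - (z jj : ℝ))|)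
      (fun z _ => ⟨y, Finset.mem_singleton_self y, le_rfl⟩) _ hw
    rw [Finset.card_singleton, Nat.cast_one] at h
    exact h
  -- the mass of the remainder class
  have hMl : ∑ p ∈ Finset.Icc 1 s, ∑ Δ ∈ cls 1 p, ∑ n ∈ admissible p D,
      |a p (fun i => (Δ i : B1Eq324BenfattoLemma.Site d)) n| *
        Real.exp (-(ϰ / 2) * connLength fun i => (Δ i : B1Eq324BenfattoLemma.Site d)) *
        Real.exp (δ / 2 * ((D : ℝ) ^ 2 * (Real.sqrt d * connLength (fun i => (Δ i : B1Eq324BenfattoLemma.Site d)) + d))) ≤ Ml := by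
    have hc' : 0 < c / 2 := by positivity
    have hw : ∀ p ∈ Finset.Icc 1 s, ∀ Δ ∈ cls 1 p, ∀ n ∈ admissible p D,
        |a p (fun i => (Δ i : B1Eq324BenfattoLemma.Site d)) n| *
          Real.exp (-(ϰ / 2) * connLength fun i => (Δ i : B1Eq324BenfattoLemma.Site d)) *
          Real.exp (δ / 2 * ((D : ℝ) ^ 2 * (Real.sqrt d * connLength (fun i => (Δ i : B1Eq324BenfattoLemma.Site d)) + d))) ≤
          A * Real.exp (δ / 2 * ((D : ℝ) ^ 2 * d)) * Real.exp (-(c / 2 * w)) *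
            Real.exp (-(c / 2 * connLength fun i => (Δ i : B1Eq324BenfattoLemma.Site d))) := by
      intro p hp Δ hΔ n _
      have hΔ' : Δ ∈ Finset.univ \ hatTuples J p L w B := by
        simpa only [hcls, one_ne_zero, if_false] using hΔ
      have hdw := le_connLength_of_mem_remainder (w := w) hL hB hΔ'
      rw [mul_assoc, hexpθ Δ]
      have hsplit : Real.exp (-(c * connLength fun i => (Δ i : B1Eq324BenfattoLemma.Site d))) ≤
          Real.exp (-(c / 2 * w)) * Real.exp (-(c / 2 * connLength fun i => (Δ i : B1Eq324BenfattoLemma.Site d))) := by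
        rw [← Real.exp_add, Real.exp_le_exp]
        nlinarith
      calc |a p (fun i => (Δ i : B1Eq324BenfattoLemma.Site d)) n| *
            (Real.exp (δ / 2 * ((D : ℝ) ^ 2 * d)) * Real.exp (-(c * connLength fun i => (Δ i : B1Eq324BenfattoLemma.Site d))))
          ≤ A * (Real.exp (δ / 2 * ((D : ℝ) ^ 2 * d)) * (Real.exp (-(c / 2 * w)) *
              Real.exp (-(c / 2 * connLength fun i => (Δ i : B1Eq324BenfattoLemma.Site d))))) :=
            mul_le_mul (hA p _ n) (mul_le_mul_of_nonneg_left hsplit (Real.exp_pos _).le) (by positivity) hA0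
        _ = A * Real.exp (δ / 2 * ((D : ℝ) ^ 2 * d)) * Real.exp (-(c / 2 * w)) *
              Real.exp (-(c / 2 * connLength fun i => (Δ i : B1Eq324BenfattoLemma.Site d))) := by ring
    exact classSum_le_card_mul (s := s) (D := D) (Jr := J) hc'
      (mul_nonneg (mul_nonneg hA0 (Real.exp_pos _).le) (Real.exp_pos _).le) (cls 1) J (fun p _ Δ _ i => (Δ i).2) _ hw
  have hMh0 : 0 ≤ Mh := by
    have := hMh 0 0
    exact le_trans (Finset.sum_nonneg fun p _ => Finset.sum_nonneg fun Δ _ => Finset.sum_nonneg fun n _ =>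
      mul_nonneg (mul_nonneg (abs_nonneg _) (Real.exp_pos _).le) (mul_nonneg (Real.exp_pos _).le (Real.exp_pos _).le)) this
  have hMl0 : 0 ≤ Ml :=
    le_trans (Finset.sum_nonneg fun p _ => Finset.sum_nonneg fun Δ _ => Finset.sum_nonneg fun n _ =>
      mul_nonneg (mul_nonneg (abs_nonneg _) (Real.exp_pos _).le) (Real.exp_pos _).le) hMl
  -- each colouring that uses colour 1
  have hcol : ∀ f : Fin (k + 1) → Fin 2, (∃ j, f j = 1) →
      |ursellOf (fun P : Finset (Fin (k + 1)) => ∫ z, ∏ j ∈ P, Y (f j) z ∂μ) Finset.univ| ≤ C * Ml * Mh ^ k := by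
    intro f hf
    obtain ⟨j₁, hj₁⟩ := hf
    have h := abs_ursellOf_tupleSums_kernel_le_anchored_of_uniform (s := s) (D := D) (ϰ := ϰ) (a := a)
      (σ := Fin (k + 1)) hK hdiag (fun j => cls (f j)) hK₀ hdec hδ.le hδle j₁ (fun _ => Mh) (fun j _ y => hMh (f j) y)
    rw [Fintype.card_fin, Finset.prod_const, Finset.card_erase_of_mem (Finset.mem_univ j₁), Finset.card_univ,
      Fintype.card_fin, Nat.add_sub_cancel] at h
    refine h.trans ?_
    rw [hj₁]
    exact mul_le_mul_of_nonneg_right (mul_le_mul_of_nonneg_left hMl hC0) (pow_nonneg hMh0 _)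
  -- sum over the colourings
  calc |∑ f ∈ Finset.univ.filter (fun f : Fin (k + 1) → Fin 2 => ∃ j, f j = 1),
        ursellOf (fun P : Finset (Fin (k + 1)) => ∫ z, ∏ j ∈ P, Y (f j) z ∂μ) Finset.univ|
      ≤ ∑ f ∈ Finset.univ.filter (fun f : Fin (k + 1) → Fin 2 => ∃ j, f j = 1),
          |ursellOf (fun P : Finset (Fin (k + 1)) => ∫ z, ∏ j ∈ P, Y (f j) z ∂μ) Finset.univ| := Finset.abs_sum_le_sum_abs _ _
    _ ≤ ∑ f ∈ Finset.univ.filter (fun f : Fin (k + 1) → Fin 2 => ∃ j, f j = 1), C * Ml * Mh ^ k :=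
        Finset.sum_le_sum fun f hf => hcol f (Finset.mem_filter.1 hf).2
    _ ≤ ∑ _f : Fin (k + 1) → Fin 2, C * Ml * Mh ^ k :=
        Finset.sum_le_sum_of_subset_of_nonneg (Finset.filter_subset _ _) fun f _ _ =>
          mul_nonneg (mul_nonneg hC0 hMl0) (pow_nonneg hMh0 _)
    _ = 2 ^ (k + 1) * C * Ml * Mh ^ k := by
        rw [Finset.sum_const, Finset.card_univ, Fintype.card_fun, Fintype.card_fin, Fintype.card_fin, nsmul_eq_mul]
        push_cast
        ring

/-- **THE SQUARE BRACKET OF (4.6)–(4.7) WITH `Ĥ_J` IN PLACE OF `H_J`, CENTRED KERNEL FIELD**: summing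
`abs_truncatedExp_kernel_hamiltonian_sub_hatH_le` over the orders `1 ≤ k ≤ t` with the `1/k!` of `cumulantSum`.  The concrete
`…HlCumulants.abs_cumulantSum_hamiltonian_sub_hatH_le` is the instance `K := freeCov d α β`. [cite: BenfattoEtAl1978, (5.11) p.155 and (4.6)–(4.7) p.152] -/
theorem abs_cumulantSum_kernel_hamiltonian_sub_hatH_le (hK : IsPosSemidefKernel K) {c₀ : ℝ≥0} (hdiag : ∀ y, K y y ≤ c₀)
    {K₀ δ₀ : ℝ} (hK₀ : 1 ≤ K₀)
    (hdec : ∀ x y : B1Eq324BenfattoLemma.Site d, |K x y| ≤ K₀ * Real.exp (-(δ₀ * ∑ jj, |((x jj : ℝ) - (y jj : ℝ))|)))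
    (hJ : CoefSupportedIn a J) {A : ℝ}
    (hA0 : 0 ≤ A) (hA : ∀ (p : ℕ) (Δ : Fin p → B1Eq324BenfattoLemma.Site d) (n : Fin p → ℕ), |a p Δ n| ≤ A)
    (hL : 0 < L) (hB : J.image (boxIndex L) ⊆ B) {δ : ℝ} (hδ : 0 < δ) (hδle : δ ≤ δ₀)
    (hδϰ : δ * ((D : ℝ) ^ 2 * Real.sqrt d) < ϰ) (w t : ℕ) :
    |cumulantSum (gaussianFieldOfKernel K) (hamiltonian s D ϰ a J) t - cumulantSum (gaussianFieldOfKernel K) (hatH s D ϰ a L w B) t| ≤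
      ∑ k ∈ Finset.Icc 1 t, (2 ^ k * (2 ^ (k * D) * 2 ^ 2 ^ (k * D) * K₀ ^ (k * D)) *
        ((A * Real.exp (δ / 2 * ((D : ℝ) ^ 2 * d)) *
            Real.exp (-((ϰ / 2 - δ / 2 * ((D : ℝ) ^ 2 * Real.sqrt d)) / 2 * w))) * J.card *
          ∑ p ∈ Finset.Icc 1 s, ((admissible p D).card : ℝ) *
            ((2 / (1 - Real.exp (-((ϰ / 2 - δ / 2 * ((D : ℝ) ^ 2 * Real.sqrt d)) / 2 / (p : ℕ) / Real.sqrt d))) *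
              Real.exp ((ϰ / 2 - δ / 2 * ((D : ℝ) ^ 2 * Real.sqrt d)) / 2 / (p : ℕ) / Real.sqrt d)) ^ d) ^ (p - 1)) *
        (A * Real.exp (δ / 2 * ((D : ℝ) ^ 2 * d)) *
          ((1 : ℝ) * (2 / (1 - Real.exp (-(δ / (2 * ((k : ℕ) : ℝ)) / Real.sqrt d))) *
            Real.exp (δ / (2 * ((k : ℕ) : ℝ)) / Real.sqrt d)) ^ d) *
          ∑ p ∈ Finset.Icc 1 s, ((admissible p D).card : ℝ) *
            ((2 / (1 - Real.exp (-((ϰ / 2 - δ / 2 * ((D : ℝ) ^ 2 * Real.sqrt d)) / (p : ℕ) / Real.sqrt d))) *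
              Real.exp ((ϰ / 2 - δ / 2 * ((D : ℝ) ^ 2 * Real.sqrt d)) / (p : ℕ) / Real.sqrt d)) ^ d) ^ (p - 1)) ^ (k - 1)) /
        (k.factorial : ℝ) := by
  rw [cumulantSum, cumulantSum, ← Finset.sum_sub_distrib]
  refine (Finset.abs_sum_le_sum_abs _ _).trans (Finset.sum_le_sum fun k hk => ?_)
  have hk1 : 1 ≤ k := (Finset.mem_Icc.1 hk).1
  obtain ⟨k', rfl⟩ := Nat.exists_eq_succ_of_ne_zero (Nat.one_le_iff_ne_zero.1 hk1)
  simp only [Nat.succ_eq_add_one, Nat.add_sub_cancel]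
  rw [← sub_div, abs_div, abs_of_pos (by positivity : (0 : ℝ) < ((k' + 1).factorial : ℝ))]
  refine div_le_div_of_nonneg_right ?_ (by positivity)
  have h := abs_truncatedExp_kernel_hamiltonian_sub_hatH_le (s := s) (D := D) (ϰ := ϰ) (B := B) hK hdiag hK₀ hdec hJ hA0 hA hL hB hδ hδle
    hδϰ w k'
  simpa only [Nat.cast_add, Nat.cast_one, Nat.cast_succ] using h

end Literature.MathematicalPhysics.QuantumFieldTheory.Balaban1983to89.B1Eq324BenfattoKernelSect5HlCumulants

end
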